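import Literature.Geometry.Riemannian.ExpMapEnergyTaylor
import Literature.Geometry.Riemannian.ABPNoConjugate
import Literature.Geometry.Riemannian.VolumeSphereTheoremJacobiFrameProofs
import Literature.Geometry.Lorentzian.GaussFormulaTangentialGeneral
import Literature.Geometry.Riemannian.TensionFieldSmooth
import Mathlib.Geometry.Manifold.PartitionOfUnity
import HarnessLib

/-!
# Brendle's ABP method: the second variation inequality in a parallel orthonormal frame
# (Brendle, CPAM 76 (2023), proof of Lemma 2.4, first display)

Topic `Geometry/Riemannian`. Brendle's Lemma 2.4 ("no conjugate points along the contact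
geodesic") starts from Lemma 2.3, `D²u(X(0),X(0)) + ∫₀ʳ (|D_tX|² − R(γ̄',X,γ̄',X)) ≥ 0` for every
smooth `X` along `γ̄` with `X(r) = 0`, and reads it in a parallel orthonormal frame `{eᵢ(t)}`
along `γ̄`: for `X_k = ∑ᵢ Z_{ik} eᵢ` with a smooth matrix curve `Z`, `Z(r) = 0`,

  `0 ≤ tr(Z(0)ᵀ H Z(0)) + ∫₀ʳ (tr(Z'ᵀ Z') − tr(Zᵀ R Z)) dt`,

where `H_{ik} = Hess u(e_k(0), e_i(0))` and `R_{ij}(t) = g(R(e_j, γ̄')γ̄', e_i)` — exactly the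
hypothesis `hSV` of the matrix form of Lemma 2.4 (`isUnit_det_jacobi_of_secondVariation`,
`ABPNoConjugate.lean`). This file proves that translation:

* `exists_contDiff_plateau` — a smooth plateau function on `ℝ` (smooth Urysohn);
* `cbilin_sum_smul_sum_smul_expand`, `bilinForm_sum_smul_sum_smul`,
  `bilin_sum_smul_sum_smul_of_orthonormal`,
  `trilin_sum_smul` — expansions of (bi/tri)linear expressions in a frame;
* `secondVariation_matrix_of_fields` — **fields to matrices**: if the second variation
  inequality holds for every smooth field `X` along `γ` with `X(r) = 0`, then `hSV` holds for
  every smooth matrix curve `Z` with `Z(r) = 0`, for any frame which is parallel, smooth and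
  orthonormal on an open interval `(a, b) ⊇ [0, r]` (the fields `X_k = ∑ᵢ (χZ)_{ik} eᵢ`, with a
  plateau `χ = 1` near `[0, r]` supported in `(a, b)`, are globally smooth;
  `D_tX_k = ∑ᵢ Z'_{ik} eᵢ` by the Leibniz rule and `D_t eᵢ = 0`; `|D_tX_k|² = (Z'ᵀZ')_{kk}`,
  `g(R(X_k,γ')X_k,γ') = −(ZᵀRZ)_{kk}` by skew-adjointness of `R`, `Hess u(X_k(0),X_k(0)) =
  (Z(0)ᵀHZ(0))_{kk}`; sum over `k`);
* `exists_global_frame_of_local` — a frame parallel/smooth/orthonormal on `(a, b)` can be replaced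
  by one with GLOBALLY smooth lifts, parallel and orthonormal on a smaller `(a', b')` and equal to
  the old one on `[a', b']` (multiply by a plateau), as needed for the global smoothness
  hypotheses of `isUnit_det_jacobi_of_secondVariation`.

Pure proofs; no definitions, no named facts.

## References

* [Brendle2022] S. Brendle, CPAM 76 (2023) 2192–2218 (arXiv:2009.13717), §2, Lemmas 2.3–2.4
  (p. 5 of the arXiv text). READ.
* B. O'Neill, *Semi-Riemannian geometry* (1983), Ch. 3, Prop. 3.18, Prop. 3.36. [ONeill1983]
-/

noncomputable section

open Bundle Set Filter Function MeasureTheory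
open scoped Manifold ContDiff Topology Matrix Matrix.Norms.Operator

namespace Literature.Geometry.Riemannian

open Literature.Geometry.Lorentzian
open Literature.Geometry.Lorentzian.PseudoRiemannianMetric

/-! ### A smooth plateau function on the line -/

/-- **A smooth plateau function on the line**: for `a < a'` and `b' < b` there is a `C^∞`
function `χ : ℝ → ℝ` with `χ = 1` on `[a', b']` and `χ = 0` on `(-∞, (a+a')/2]` and on
`[(b'+b)/2, ∞)` (smooth Urysohn lemma `exists_contMDiffMap_zero_one_of_isClosed`). [folklore] -/
theorem exists_contDiff_plateau {a a' b' b : ℝ} (ha : a < a') (hb : b' < b) :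
    ∃ χ : ℝ → ℝ, ContDiff ℝ ∞ χ ∧ (∀ t ∈ Icc a' b', χ t = 1) ∧
      (∀ t, t ≤ (a + a') / 2 → χ t = 0) ∧ (∀ t, (b' + b) / 2 ≤ t → χ t = 0) := by
  have hs : IsClosed (Ioo ((a + a') / 2) ((b' + b) / 2))ᶜ := isOpen_Ioo.isClosed_compl
  have ht : IsClosed (Icc a' b') := isClosed_Icc
  have hd : Disjoint (Ioo ((a + a') / 2) ((b' + b) / 2))ᶜ (Icc a' b') := by
    rw [disjoint_compl_left_iff_subset]
    exact Icc_subset_Ioo (by linarith) (by linarith)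
  obtain ⟨f, hf0, hf1, -⟩ := exists_contMDiffMap_zero_one_of_isClosed (I := 𝓘(ℝ, ℝ)) (M := ℝ)
    (n := ⊤) hs ht hd
  refine ⟨f, contMDiff_iff_contDiff.1 f.contMDiff, fun t ht ↦ hf1 ht, fun t ht ↦ hf0 ?_,
    fun t ht ↦ hf0 ?_⟩
  · simp only [mem_compl_iff, mem_Ioo, not_and, not_lt]; intro h; linarith
  · simp only [mem_compl_iff, mem_Ioo, not_and, not_lt]; intro; exact ht

/-! ### Algebra in an orthonormal frame -/

section FrameAlgebra

variable {V : Type*} [NormedAddCommGroup V] [NormedSpace ℝ V] {ι : Type*} [Fintype ι]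

/-- `B(∑ cᵢeᵢ, ∑ dⱼeⱼ) = ∑ᵢ∑ⱼ dᵢ cⱼ B(eⱼ, eᵢ)` for a continuous bilinear `B`. [folklore] -/
theorem cbilin_sum_smul_sum_smul_expand (B : V →L[ℝ] V →L[ℝ] ℝ) (e : ι → V) (c d : ι → ℝ) :
    B (∑ i, c i • e i) (∑ j, d j • e j) = ∑ i, ∑ j, d i * c j * B (e j) (e i) := by
  simp only [map_sum, map_smul, FunLike.coe_sum, FunLike.coe_smul,
    Finset.sum_apply, Pi.smul_apply, smul_eq_mul, Finset.mul_sum]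
  refine Finset.sum_congr rfl fun i _ ↦ Finset.sum_congr rfl fun j _ ↦ by ring

/-- `B(∑ cᵢeᵢ, ∑ dⱼeⱼ) = ∑ᵢ cᵢdᵢ` for a `B`-orthonormal family `e`. [folklore] -/
theorem bilin_sum_smul_sum_smul_of_orthonormal [DecidableEq ι] (B : V →L[ℝ] V →L[ℝ] ℝ)
    {e : ι → V} (hon : ∀ i j, B (e i) (e j) = if i = j then 1 else 0) (c d : ι → ℝ) :
    B (∑ i, c i • e i) (∑ j, d j • e j) = ∑ i, c i * d i := by
  rw [cbilin_sum_smul_sum_smul_expand]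
  refine Finset.sum_congr rfl fun i _ ↦ ?_
  simp only [hon, mul_ite, mul_one, mul_zero, Finset.sum_ite_eq', Finset.mem_univ, if_true]
  ring

/-- `B(∑ cᵢeᵢ, ∑ dⱼeⱼ) = ∑ᵢ∑ⱼ dᵢ cⱼ B(eⱼ, eᵢ)` for a bilinear form `B`. [folklore] -/
theorem bilinForm_sum_smul_sum_smul {W : Type*} [AddCommGroup W] [Module ℝ W]
    (B : LinearMap.BilinForm ℝ W) (e : ι → W) (c d : ι → ℝ) :
    B (∑ i, c i • e i) (∑ j, d j • e j) = ∑ i, ∑ j, d i * c j * B (e j) (e i) := by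
  simp only [map_sum, map_smul, LinearMap.coe_sum, LinearMap.smul_apply, Finset.sum_apply,
    smul_eq_mul, Finset.mul_sum]
  refine Finset.sum_congr rfl fun i _ ↦ Finset.sum_congr rfl fun j _ ↦ by ring

set_option synthInstance.maxHeartbeats 400000 in
/-- `G(Rm(∑ cᵢeᵢ, T)(∑ cⱼeⱼ), T) = ∑ᵢ∑ⱼ cᵢcⱼ G(Rm(eⱼ,T)eᵢ, T)` for continuous multilinear `Rm`, `G`
(expansion of the curvature term of the index form in a frame). [folklore] -/
theorem trilin_sum_smul (Rm : V →L[ℝ] V →L[ℝ] V →L[ℝ] V) (G : V →L[ℝ] V →L[ℝ] ℝ) (e : ι → V)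
    (c : ι → ℝ) (T : V) :
    G (Rm (∑ i, c i • e i) T (∑ j, c j • e j)) T =
      ∑ i, ∑ j, c i * c j * G (Rm (e j) T (e i)) T := by
  simp only [map_sum, map_smul, FunLike.coe_sum, FunLike.coe_smul, Finset.sum_apply,
    Pi.smul_apply, smul_eq_mul, Finset.mul_sum]
  refine Finset.sum_congr rfl fun i _ ↦ Finset.sum_congr rfl fun j _ ↦ by ring

end FrameAlgebra


/-! ### The second variation along frame fields: from fields to matrices -/

section FrameSecondVariation

variable {E : Type*} [NormedAddCommGroup E] [NormedSpace ℝ E] {H : Type*} [TopologicalSpace H]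
  {I : ModelWithCorners ℝ E H} {M : Type*} [TopologicalSpace M] [ChartedSpace H M]
  [IsManifold I ∞ M] {n : ℕ∞ω} [FiniteDimensional ℝ E] [CompleteSpace E]
  (g : PseudoRiemannianMetric I n E (TangentSpace I : M → Type _)) [g.HasLeviCivita]
  [T2Space M] [BoundarylessManifold I M]
  [CovariantDerivative.ContMDiffCovariantDerivative g.leviCivita 1]
  [CovariantDerivative.ContMDiffCovariantDerivative g.leviCivita ∞]

set_option maxHeartbeats 1600000 in
/-- **The second variation inequality, from fields to matrices** (Brendle 2023, proof of
Lemma 2.4, first display: "`∫₀ʳ (|X'|² − R(γ̄',X,γ̄',X)) + D²u(X(0),X(0)) ≥ 0` for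
`X = ∑ Z_{ik} eᵢ` in a parallel orthonormal frame"). Let `γ` be a smooth curve of a complete
smooth metric, `e` a frame along `γ` which is parallel, smooth and orthonormal on `(a, b)`,
`a < 0 < r < b`, and suppose `0 ≤ Hess u(X0,X0) + ∫₀ʳ [g(R(X,γ')X,γ') + |D_tX|²]` for every
globally smooth field `X` along `γ` with `X(r) = 0`. Then for every smooth matrix curve `Z` with
`Z(r) = 0`, `0 ≤ tr(Z(0)ᵀ H Z(0)) + ∫₀ʳ (tr(Z'ᵀZ') − tr(Zᵀ R Z))` with
`H_{ik} = Hess u(γ 0)(e_k 0, e_i 0)` and `R_{ij}(t) = g(R(e_j,γ')γ', e_i)` — the hypothesis `hSV` of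
`isUnit_det_jacobi_of_secondVariation`. See the module docstring for the proof.
[cite: Brendle2022, Lemma 2.4 (proof)] -/
theorem secondVariation_matrix_of_fields (hn : (∞ : ℕ∞ω) ≤ n)
    (hc : IsGeodesicallyComplete g.leviCivita) {γ : ℝ → M} (hγ : ContMDiff 𝓘(ℝ, ℝ) I ∞ γ)
    {r a b : ℝ} (hr : 0 < r) (ha : a < 0) (hb : r < b) {ι : Type*} [Fintype ι] [DecidableEq ι]
    {e : ι → Π t : ℝ, TangentSpace I (γ t)}
    (hpar : ∀ i, IsParallelAlongOn g.leviCivita γ (e i) (Ioo a b))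
    (hes : ∀ i, ∀ t ∈ Ioo a b, ContMDiffAt 𝓘(ℝ, ℝ) I.tangent ∞
      (fun t' ↦ (TotalSpace.mk' E (γ t') (e i t') : TangentBundle I M)) t)
    (hon : ∀ t ∈ Ioo a b, ∀ i j, g.val (γ t) (e i t) (e j t) = if i = j then 1 else 0)
    {u : M → ℝ}
    (hSV0 : ∀ X : Π t : ℝ, TangentSpace I (γ t),
      ContMDiff 𝓘(ℝ, ℝ) I.tangent ∞ (fun t ↦ (TotalSpace.mk' E (γ t) (X t) : TangentBundle I M)) →
      X r = 0 →
      0 ≤ g.hessian u (γ 0) (X 0) (X 0) + ∫ t in (0 : ℝ)..r,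
        (g.val (γ t) (g.leviCivita.curvature (γ t) (X t) (velocity I γ t) (X t))
            (velocity I γ t) +
          g.val (γ t) (covariantDerivAlong g.leviCivita γ X t)
            (covariantDerivAlong g.leviCivita γ X t)))
    (Z : ℝ → Matrix ι ι ℝ) (hZ : ContDiff ℝ ∞ Z) (hZr : Z r = 0) :
    0 ≤ ((Z 0)ᵀ * ((Matrix.of fun i k ↦ g.hessian u (γ 0) (e k 0) (e i 0)) * Z 0)).trace +
      ∫ t in (0 : ℝ)..r, (((deriv Z t)ᵀ * deriv Z t).trace -
        ((Z t)ᵀ * ((Matrix.of fun i j ↦ g.val (γ t) (g.leviCivita.curvature (γ t) (e j t)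
          (velocity I γ t) (velocity I γ t)) (e i t)) * Z t)).trace) := by
  haveI : Fact (1 ≤ n) := ⟨le_trans (by exact_mod_cast le_top) hn⟩
  have hLC : g.IsLeviCivita g.leviCivita := isLeviCivita_leviCivita_holds (g := g)
  have hreg1 : g.leviCivita.IsLocallyContMDiff 1 :=
    g.isLocallyContMDiff_leviCivita_holds 1
      ((show ((1 : ℕ∞) : ℕ∞ω) + 1 ≤ ∞ from WithTop.coe_le_coe.2 le_top).trans hn)
  have h2 : (2 : ℕ∞ω) ≤ ∞ := WithTop.coe_le_coe.2 le_top
  have hn2 : (2 : ℕ∞ω) ≤ n := h2.trans hn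
  -- a plateau `χ = 1` near `[0, r]`, `χ = 0` off a compact part of `(a, b)`
  obtain ⟨χ, hχs, hχ1, hχa, hχb⟩ := exists_contDiff_plateau (a := a / 2) (a' := a / 4)
    (b' := r + (b - r) / 4) (b := r + (b - r) / 2) (by linarith) (by linarith)
  -- the truncated matrix curve `Y = χ Z`
  set Y : ℝ → Matrix ι ι ℝ := fun t ↦ χ t • Z t with hY_def
  have hY : ContDiff ℝ ∞ Y := hχs.smul hZ
  have hYik : ∀ i k, ContDiff ℝ ∞ fun t ↦ Y t i k := fun i k ↦
    (LinearMap.toContinuousLinearMap (Matrix.entryLinearMap ℝ ℝ i k)).contDiff.comp hY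
  have hYZ : ∀ t ∈ Ioo (a / 4) (r + (b - r) / 4), Y =ᶠ[𝓝 t] Z := by
    intro t ht
    filter_upwards [Ioo_mem_nhds ht.1 ht.2] with s hs
    show χ s • Z s = Z s
    rw [hχ1 s ⟨hs.1.le, hs.2.le⟩, one_smul]
  have hYZ_eq : ∀ t ∈ Icc 0 r, Y t = Z t := fun t ht ↦
    (hYZ t ⟨by linarith [ht.1], by linarith [ht.2]⟩).self_of_nhds
  have hYZ_deriv : ∀ t ∈ Icc 0 r, deriv Y t = deriv Z t := fun t ht ↦
    (hYZ t ⟨by linarith [ht.1], by linarith [ht.2]⟩).deriv_eq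
  have hY0 : ∀ t, t ∉ Ioo a b → ∀ᶠ s in 𝓝 t, Y s = 0 := by
    intro t ht
    rcases le_or_gt t a with hta | hta
    · filter_upwards [Iio_mem_nhds (show t < a / 2 by linarith)] with s hs
      show χ s • Z s = 0
      rw [hχa s (by linarith [(show s < a / 2 from hs).le]), zero_smul]
    · have htb : b ≤ t := by
        by_contra h; push Not at h; exact ht ⟨hta, h⟩
      filter_upwards [Ioi_mem_nhds (show r + (b - r) / 2 < t by linarith)] with s hs
      show χ s • Z s = 0
      rw [hχb s (by linarith [(show r + (b - r) / 2 < s from hs).le]), zero_smul]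
  -- the frame fields `X_k = ∑ᵢ Y_{ik} eᵢ`
  set X : ι → Π t : ℝ, TangentSpace I (γ t) := fun k t ↦ ∑ i, Y t i k • e i t with hX_def
  have hXs : ∀ k, ContMDiff 𝓘(ℝ, ℝ) I.tangent ∞
      (fun t ↦ (TotalSpace.mk' E (γ t) (X k t) : TangentBundle I M)) := by
    intro k t
    by_cases ht : t ∈ Ioo a b
    · exact HarmonicMap.contMDiffAt_lift_sum Finset.univ (hγ t) fun i _ ↦
        HarmonicMap.contMDiffAt_lift_smul (hes i t ht) (hYik i k).contMDiff.contMDiffAt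
    · have hzero : ContMDiffAt 𝓘(ℝ, ℝ) I.tangent ∞
          (fun t ↦ (TotalSpace.mk' E (γ t) (0 : TangentSpace I (γ t)) : TangentBundle I M)) t :=
        (Bundle.contMDiff_zeroSection ℝ (TangentSpace I : M → Type _)).contMDiffAt.comp t (hγ t)
      refine hzero.congr_of_eventuallyEq ?_
      filter_upwards [hY0 t ht] with s hs
      show (TotalSpace.mk' E (γ s) (∑ i, Y s i k • e i s) : TangentBundle I M) =
        TotalSpace.mk' E (γ s) 0
      simp only [hs, Matrix.zero_apply, zero_smul, Finset.sum_const_zero]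
  have hXr : ∀ k, X k r = 0 := fun k ↦ by
    show ∑ i, Y r i k • e i r = 0
    simp only [hYZ_eq r ⟨hr.le, le_rfl⟩, hZr, Matrix.zero_apply, zero_smul,
      Finset.sum_const_zero]
  -- the covariant derivative of `X_k` on `[0, r]`
  have hIcc : ∀ t ∈ Icc (0 : ℝ) r, t ∈ Ioo a b := fun t ht ↦
    ⟨by linarith [ht.1], by linarith [ht.2]⟩
  have hDX : ∀ k, ∀ t ∈ Icc (0 : ℝ) r,
      covariantDerivAlong g.leviCivita γ (X k) t = ∑ i, deriv Z t i k • e i t := by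
    intro k t ht
    have ht' := hIcc t ht
    have h := (covariantDerivAlong_finset_sum_smul g.leviCivita Finset.univ (γ := γ)
      (W := e) (a := fun i t ↦ Y t i k) (t₀ := t) ((hγ t).mdifferentiableAt (by simp))
      (fun i _ ↦ (hpar i t ht').1) (fun i _ ↦ (hYik i k).differentiable (by simp) t)).2
    refine h.trans (Finset.sum_congr rfl fun i _ ↦ ?_)
    rw [(hpar i t ht').2, smul_zero, add_zero]
    have hd : deriv (fun s ↦ Y s i k) t = deriv Z t i k :=
      (hasDerivAt_matrix_entry ((hY.differentiable (by simp)) t).hasDerivAt i k).deriv.trans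
        (congrFun (congrFun (hYZ_deriv t ht) i) k)
    rw [hd]
  -- pointwise identification of the integrands on `[0, r]`
  have hpt : ∀ t ∈ Icc (0 : ℝ) r, ∑ k,
      (g.val (γ t) (g.leviCivita.curvature (γ t) (X k t) (velocity I γ t) (X k t))
          (velocity I γ t) +
        g.val (γ t) (covariantDerivAlong g.leviCivita γ (X k) t)
          (covariantDerivAlong g.leviCivita γ (X k) t)) =
      ((deriv Z t)ᵀ * deriv Z t).trace -
        ((Z t)ᵀ * ((Matrix.of fun i j ↦ g.val (γ t) (g.leviCivita.curvature (γ t) (e j t)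
          (velocity I γ t) (velocity I γ t)) (e i t)) * Z t)).trace := by
    intro t ht
    have ht' := hIcc t ht
    -- kinetic term
    have hkin : ∀ k, g.val (γ t) (covariantDerivAlong g.leviCivita γ (X k) t)
        (covariantDerivAlong g.leviCivita γ (X k) t) = ∑ i, deriv Z t i k * deriv Z t i k := by
      intro k
      rw [hDX k t ht]
      exact bilin_sum_smul_sum_smul_of_orthonormal (V := E) (g.val (γ t)) (hon t ht') _ _
    -- curvature term
    have hcurv : ∀ k, g.val (γ t) (g.leviCivita.curvature (γ t) (X k t) (velocity I γ t) (X k t))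
        (velocity I γ t) = -∑ i, ∑ j, Z t i k * Z t j k *
          g.val (γ t) (g.leviCivita.curvature (γ t) (e j t) (velocity I γ t) (velocity I γ t))
            (e i t) := by
      intro k
      have hXk : X k t = ∑ i, Z t i k • e i t := by
        show ∑ i, Y t i k • e i t = _
        rw [hYZ_eq t ht]
      rw [hXk]
      refine (trilin_sum_smul (V := E) (g.leviCivita.curvature (γ t)) (g.val (γ t))
        (fun i ↦ e i t) (fun i ↦ Z t i k) (velocity I γ t)).trans ?_
      rw [← Finset.sum_neg_distrib]
      refine Finset.sum_congr rfl fun i _ ↦ ?_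
      rw [← Finset.sum_neg_distrib]
      refine Finset.sum_congr rfl fun j _ ↦ ?_
      have hsk := val_curvature_skew hLC.2 hreg1 hn2 (γ t) (e j t) (velocity I γ t) (e i t)
        (velocity I γ t)
      linear_combination (Z t i k * Z t j k) * hsk
    have hK : ∑ k, g.val (γ t) (covariantDerivAlong g.leviCivita γ (X k) t)
        (covariantDerivAlong g.leviCivita γ (X k) t) = ((deriv Z t)ᵀ * deriv Z t).trace := by
      simp only [hkin, Matrix.trace, Matrix.diag_apply, Matrix.mul_apply, Matrix.transpose_apply]
    have hS : ∑ k, g.val (γ t) (g.leviCivita.curvature (γ t) (X k t) (velocity I γ t) (X k t))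
        (velocity I γ t) = -((Z t)ᵀ * ((Matrix.of fun i j ↦ g.val (γ t)
          (g.leviCivita.curvature (γ t) (e j t) (velocity I γ t) (velocity I γ t)) (e i t)) *
            Z t)).trace := by
      simp only [hcurv, Matrix.trace, Matrix.diag_apply, Matrix.mul_apply, Matrix.transpose_apply,
        Matrix.of_apply, Finset.sum_neg_distrib]
      congr 1
      refine Finset.sum_congr rfl fun k _ ↦ Finset.sum_congr rfl fun i _ ↦ ?_
      rw [Finset.mul_sum]
      refine Finset.sum_congr rfl fun j _ ↦ ?_
      ring
    rw [Finset.sum_add_distrib, hK, hS]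
    ring
  -- the Hessian term
  have hHess : ∑ k, g.hessian u (γ 0) (X k 0) (X k 0) =
      ((Z 0)ᵀ * ((Matrix.of fun i k ↦ g.hessian u (γ 0) (e k 0) (e i 0)) * Z 0)).trace := by
    have hX0 : ∀ k, X k 0 = ∑ i, Z 0 i k • e i 0 := fun k ↦ by
      show ∑ i, Y 0 i k • e i 0 = _
      rw [hYZ_eq 0 ⟨le_rfl, hr.le⟩]
    have hk : ∀ k, g.hessian u (γ 0) (X k 0) (X k 0) =
        ∑ i, ∑ j, Z 0 i k * Z 0 j k * g.hessian u (γ 0) (e j 0) (e i 0) := fun k ↦ by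
      rw [hX0 k]
      exact bilinForm_sum_smul_sum_smul (g.hessian u (γ 0)) (fun i ↦ e i 0) _ _
    simp only [hk, Matrix.trace, Matrix.diag_apply, Matrix.mul_apply, Matrix.transpose_apply,
      Matrix.of_apply]
    refine Finset.sum_congr rfl fun k _ ↦ Finset.sum_congr rfl fun i _ ↦ ?_
    rw [Finset.mul_sum]
    refine Finset.sum_congr rfl fun j _ ↦ ?_
    ring
  -- continuity of the integrands and summation of the inequalities
  have hcont : ∀ k, Continuous fun t ↦
      (g.val (γ t) (g.leviCivita.curvature (γ t) (X k t) (velocity I γ t) (X k t))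
          (velocity I γ t) +
        g.val (γ t) (covariantDerivAlong g.leviCivita γ (X k) t)
          (covariantDerivAlong g.leviCivita γ (X k) t)) := fun k ↦
    (integral_energy_le_taylor g hn hc (hXs k) hr.le).1
  have hsum := Finset.sum_nonneg fun k (_ : k ∈ Finset.univ) ↦ hSV0 (X k) (hXs k) (hXr k)
  rw [Finset.sum_add_distrib, hHess, ← intervalIntegral.integral_finsetSum (fun k _ ↦
    ((hcont k).intervalIntegrable 0 r))] at hsum
  refine hsum.trans_eq ?_
  congr 1
  refine intervalIntegral.integral_congr fun t ht ↦ ?_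
  rw [uIcc_of_le hr.le] at ht
  exact hpt t ht


omit [CompleteSpace E] [T2Space M] [BoundarylessManifold I M]
  [CovariantDerivative.ContMDiffCovariantDerivative g.leviCivita 1]
  [CovariantDerivative.ContMDiffCovariantDerivative g.leviCivita ∞] in
/-- **Globalizing a local parallel orthonormal frame.** A frame along a smooth curve `γ` which is
parallel, smooth and orthonormal on `(a, b)` can be replaced, for `a < a' ≤ b' < b`, by the frame
`χ eᵢ` (`χ` a plateau, `= 1` on `[a', b']`, supported in `(a, b)`) whose lifts are smooth on all of
`ℝ`, which is parallel and orthonormal on `(a', b')` (Leibniz rule, `χ' = 0` there) and equals `e`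
on `[a', b']`. [folklore] -/
theorem exists_global_frame_of_local {γ : ℝ → M} (hγ : ContMDiff 𝓘(ℝ, ℝ) I ∞ γ)
    {a a' b' b : ℝ} (ha : a < a') (hb : b' < b) {ι : Type*} [DecidableEq ι]
    {e : ι → Π t : ℝ, TangentSpace I (γ t)}
    (hpar : ∀ i, IsParallelAlongOn g.leviCivita γ (e i) (Ioo a b))
    (hes : ∀ i, ∀ t ∈ Ioo a b, ContMDiffAt 𝓘(ℝ, ℝ) I.tangent ∞
      (fun t' ↦ (TotalSpace.mk' E (γ t') (e i t') : TangentBundle I M)) t)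
    (hon : ∀ t ∈ Ioo a b, ∀ i j, g.val (γ t) (e i t) (e j t) = if i = j then 1 else 0) :
    ∃ e' : ι → Π t : ℝ, TangentSpace I (γ t),
      (∀ i, ContMDiff 𝓘(ℝ, ℝ) I.tangent ∞
        (fun t ↦ (TotalSpace.mk' E (γ t) (e' i t) : TangentBundle I M))) ∧
      (∀ i, IsParallelAlongOn g.leviCivita γ (e' i) (Ioo a' b')) ∧
      (∀ t ∈ Ioo a' b', ∀ i j, g.val (γ t) (e' i t) (e' j t) = if i = j then 1 else 0) ∧
      ∀ i, ∀ t ∈ Icc a' b', e' i t = e i t := by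
  obtain ⟨χ, hχs, hχ1, hχa, hχb⟩ := exists_contDiff_plateau ha hb
  refine ⟨fun i t ↦ χ t • e i t, fun i t ↦ ?_, fun i t ht ↦ ?_, fun t ht i j ↦ ?_,
    fun i t ht ↦ ?_⟩
  · -- global smoothness
    by_cases ht : t ∈ Ioo a b
    · exact HarmonicMap.contMDiffAt_lift_smul (hes i t ht) hχs.contMDiff.contMDiffAt
    · have hzero : ContMDiffAt 𝓘(ℝ, ℝ) I.tangent ∞
          (fun t ↦ (TotalSpace.mk' E (γ t) (0 : TangentSpace I (γ t)) : TangentBundle I M)) t :=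
        (Bundle.contMDiff_zeroSection ℝ (TangentSpace I : M → Type _)).contMDiffAt.comp t (hγ t)
      refine hzero.congr_of_eventuallyEq ?_
      have hχ0 : ∀ᶠ s in 𝓝 t, χ s = 0 := by
        rcases le_or_gt t a with hta | hta
        · filter_upwards [Iio_mem_nhds (show t < (a + a') / 2 by linarith)] with s hs
          exact hχa s (show s < (a + a') / 2 from hs).le
        · have htb : b ≤ t := by
            by_contra h; push Not at h; exact ht ⟨hta, h⟩
          filter_upwards [Ioi_mem_nhds (show (b' + b) / 2 < t by linarith)] with s hs
          exact hχb s (show (b' + b) / 2 < s from hs).le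
      filter_upwards [hχ0] with s hs
      show (TotalSpace.mk' E (γ s) (χ s • e i s) : TangentBundle I M) = TotalSpace.mk' E (γ s) 0
      rw [hs, zero_smul]
  · -- parallel on `(a', b')`
    have htab : t ∈ Ioo a b := ⟨by linarith [ht.1], by linarith [ht.2]⟩
    have hd := mdifferentiableAt_lift_smul (hχs.differentiable (by simp) t) (hpar i t htab).1
    refine ⟨hd, ?_⟩
    rw [covariantDerivAlong_smul_holds g.leviCivita (hχs.differentiable (by simp) t)
      (hpar i t htab).1, (hpar i t htab).2, smul_zero, add_zero]
    have hχ' : deriv χ t = 0 := by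
      have hev : χ =ᶠ[𝓝 t] fun _ ↦ (1 : ℝ) := by
        filter_upwards [Ioo_mem_nhds ht.1 ht.2] with s hs
        exact hχ1 s ⟨hs.1.le, hs.2.le⟩
      rw [hev.deriv_eq, deriv_const]
    rw [hχ', zero_smul]
  · -- orthonormal on `(a', b')`
    have htab : t ∈ Ioo a b := ⟨by linarith [ht.1], by linarith [ht.2]⟩
    show g.val (γ t) (χ t • e i t) (χ t • e j t) = _
    rw [hχ1 t ⟨ht.1.le, ht.2.le⟩, one_smul, one_smul, hon t htab]
  · show χ t • e i t = e i t
    rw [hχ1 t ht, one_smul]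

end FrameSecondVariation

end Literature.Geometry.Riemannian
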